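import Summits.HubbardSuperconductivity.HubbardLadder.Bounds.PairCorrelationEtaLineDipoleTPrime
import Literature.MathematicalPhysics.QuantumLattice.TorusEuclidLogDipoleDiag
import HarnessLib
import HarnessLib.Audit

/-!
# Machine-checked SHARP Koma–Tasaki `η`-line for the `t–t'` Hubbard model (bounds.tex Theorem 10″(t′))

HONEST FRAMING: ladder R1–R4 with certified numbers; no claim on H/H₀.

Cell `pub-hubbard`, BOUNDS part (g17). `PairCorrelationEtaLineDipoleTPrime.lean` (imported; g16)
machine-checks the `ℓ^∞`-dipole Koma–Tasaki line `T ≥ 1.02(|t| + 2|t'|)` for the grand-canonical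
`t–t'` Hubbard model `H_{t,t'}(U) - μN` on the tori `(ℤ/Lℤ)²`. This file replaces the `ℓ^∞`
dipole by the explicit EUCLIDEAN truncated logarithmic dipole of
`TorusEuclidLogDipole(Diag).lean` (profile `½ log max(1, min(|u - c|₂², ρ²))`), whose
nearest-neighbour energy has the sharp coefficient `2π` and whose DIAGONAL energy has the sharp
coefficient `4π` per unit `q² log ρ` (`|e₁ ± e₂|₂² = 2`:
`Literature.MathematicalPhysics.QuantumLattice.exists_euclidLogDipole_two_graphs`). With
Koma–Tasaki's a priori bound for the two bond families (`apriori_ttPrime`, printed hopping norm)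
the exponent is `f_q = 4q - 4π β(|t| + 2|t'|) q²`, maximal `f* = 1/(π β(|t| + 2|t'|))` at
`q* = 1/(2π β(|t| + 2|t'|))` — the paper's Theorem 10 (iii) value for the class:

* `norm_pairCorr_ttPrime_le_rpow_euclid` — for all real `t, t', U, μ`, `β ≥ 0`, `q ≥ 0` with
  `f_q ≥ 0`, every `L ≥ 1` and all sites `x, y`:
  `|⟨c†_{x↑} c†_{x↓} c_{y↓} c_{y↑}⟩_{β,L}| ≤ K 5^{f_q} (dist_∞(x,y) + 1)^{-f_q}`,
  `K = exp[2β(|t|(2π q² + 76 q² + 544 q⁴ e^{2q²}) + |t'|(4π q² + 289 q² + 3402 q⁴ e^{2q²}))]`;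
* the node `PairEtaLineEuclidTPrime` — PROVED (`pairEtaLineEuclidTPrime_holds`): if
  `β(|t| + 2|t'|) < 4/π`, i.e. `T > (π/4)(|t| + 2|t'|) ≈ 0.785(|t| + 2|t'|)`, there are `f > 1/4`
  and `C` with `|G_{β,L}(x,y)| ≤ C (dist+1)^{-f}` uniformly in `L` — no algebraic pair order with
  the Nelson–Kosterlitz exponent `η ≤ 1/4` there, for ANY `U` and ANY filling. For `t' = -0.2t`
  (bounds.tex running example) the machine-checked line improves from `T ≥ 1.43|t|` (g16, `ℓ^∞`)
  to `T > 1.10|t|` (= the paper's Euclidean value `(π/4)·1.4|t|`).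

NOT claimed: optimality of the exponent within the method (bounds.tex Thm 10 (iv), harmonic
dipole — paper only), anything below the line, and any statement about `T_BKT` itself.

References (keys of `lean/references.bib`): KomaTasakiPRL1992 (Theorem, eqs. (5)–(13), note 9);
McBryanSpencer1977; NelsonKosterlitz1977; XuEtAl2024 (the `t–t'` model, eq. (1)).
-/

noncomputable section

namespace Summit.HubbardSuperconductivity.HubbardLadder.Bounds

open Matrix Finset NormedSpace
open Literature.MathematicalPhysics.QuantumLattice Literature.Probability.LatticeModels
open scoped Matrix.Norms.L2Operator ComplexOrder

/-! ### The explicit sharp power law -/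

/-- **Euclidean-dipole bound for the `t–t'` model (bounds.tex Theorem 10″(t′)), machine-checked
and explicit.** For all real `t, t', U, μ`, `β ≥ 0`, every `q ≥ 0` with
`f_q = 4q - 4π β(|t| + 2|t'|) q² ≥ 0`, every torus `L ≥ 1` and all sites `x, y`:
`|G_{β,L}(x,y)| ≤ K 5^{f_q} (dist_∞(x,y) + 1)^{-f_q}`,
`K = exp[2β(|t|(2π q² + 76 q² + 544 q⁴ e^{2q²}) + |t'|(4π q² + 289 q² + 3402 q⁴ e^{2q²}))]`
(Euclidean dipole of radius `ρ = ⌊(dist-1)/2⌋ ≥ (dist+1)/5` for `dist ≥ 3`, `H(ρ) ≤ 1 + log ρ`;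
`φ = 0` for `dist ≤ 2`). -/
theorem norm_pairCorr_ttPrime_le_rpow_euclid (L : ℕ) [NeZero L] (t t' U μ β q : ℝ)
    (hβ : 0 ≤ β) (hq : 0 ≤ q)
    (hf : 0 ≤ 4 * q - 4 * Real.pi * (β * (|t| + 2 * |t'|)) * q ^ 2) (x y : TorusSite 2 L) :
    ‖(hubbardTorusTT' L t t' U - (μ : ℂ) • totalNumber).thermalCorr β
        (onSitePair x)ᴴ (onSitePair y)‖ ≤
      Real.exp (2 * β * (|t| * (2 * Real.pi * q ^ 2 + 76 * q ^ 2 +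
            544 * q ^ 4 * Real.exp (2 * q ^ 2)) +
          |t'| * (4 * Real.pi * q ^ 2 + 289 * q ^ 2 + 3402 * q ^ 4 * Real.exp (2 * q ^ 2)))) *
        ((5 : ℝ) ^ (4 * q - 4 * Real.pi * (β * (|t| + 2 * |t'|)) * q ^ 2) *
          ((torusDist x y : ℝ) + 1) ^ (-(4 * q - 4 * Real.pi * (β * (|t| + 2 * |t'|)) * q ^ 2))) := by
  set f : ℝ := 4 * q - 4 * Real.pi * (β * (|t| + 2 * |t'|)) * q ^ 2 with hfdef
  have hf0 : 0 ≤ f := hf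
  set K : ℝ := Real.exp (2 * β * (|t| * (2 * Real.pi * q ^ 2 + 76 * q ^ 2 +
      544 * q ^ 4 * Real.exp (2 * q ^ 2)) +
    |t'| * (4 * Real.pi * q ^ 2 + 289 * q ^ 2 + 3402 * q ^ 4 * Real.exp (2 * q ^ 2)))) with hK
  have hβt : 0 ≤ β * |t| := by positivity
  have hβt' : 0 ≤ β * |t'| := by positivity
  have hK1 : 1 ≤ K := Real.one_le_exp (by positivity)
  set R : ℕ := torusDist x y with hR
  have hR1 : (0 : ℝ) < (R : ℝ) + 1 := by positivity
  by_cases hR3 : R < 3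
  · -- short distances: the bound with `φ = 0` is `1 ≤ K 5^f (R+1)^{-f}` (`R + 1 ≤ 5`)
    have h0 := apriori_ttPrime L t t' U μ β hβ x y (fun _ => 0)
    simp only [sub_self, mul_zero, Real.cosh_zero, ite_self, sum_const_zero, add_zero,
      Real.exp_zero, mul_one] at h0
    have hge1 : 1 ≤ (5 : ℝ) ^ f * ((R : ℝ) + 1) ^ (-f) := by
      rw [Real.rpow_neg hR1.le, ← div_eq_mul_inv, ← Real.div_rpow (by norm_num) hR1.le]
      refine Real.one_le_rpow ?_ hf0
      rw [le_div_iff₀ hR1]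
      have : (R : ℝ) ≤ 2 := by exact_mod_cast (by omega : R ≤ 2)
      linarith
    calc ‖(hubbardTorusTT' L t t' U - (μ : ℂ) • totalNumber).thermalCorr β
            (onSitePair x)ᴴ (onSitePair y)‖
        ≤ 1 := h0
      _ ≤ K * ((5 : ℝ) ^ f * ((R : ℝ) + 1) ^ (-f)) := by nlinarith
  · -- the Euclidean dipole of radius `ρ = ⌊(R-1)/2⌋ ≥ 1` on both bond graphs
    have hR3' : 3 ≤ R := not_lt.1 hR3
    set ρ : ℕ := (R - 1) / 2 with hρdef
    have hρ1 : 1 ≤ ρ := by omega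
    have hρR : 2 * ρ + 1 ≤ torusDist x y := by rw [← hR]; omega
    have h5ρ : R + 1 ≤ 5 * ρ := by omega
    obtain ⟨φ, hgain, hE₁, hE₂⟩ := exists_euclidLogDipole_two_graphs L x y q hq ρ hρ1 hρR
    have key := apriori_ttPrime L t t' U μ β hβ x y φ
    rw [hgain] at key
    have hρ0 : (0 : ℝ) < (ρ : ℝ) := by exact_mod_cast hρ1
    have hH : (harmonic ρ : ℝ) ≤ 1 + Real.log ρ := harmonic_le_one_add_log ρ
    have hfifth : ((R : ℝ) + 1) / 5 ≤ (ρ : ℝ) := by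
      have h' : ((R : ℝ) + 1) ≤ 5 * (ρ : ℝ) := by exact_mod_cast h5ρ
      linarith
    have hfifth0 : (0 : ℝ) < ((R : ℝ) + 1) / 5 := by positivity
    calc ‖(hubbardTorusTT' L t t' U - (μ : ℂ) • totalNumber).thermalCorr β
            (onSitePair x)ᴴ (onSitePair y)‖
        ≤ Real.exp (-2 * (2 * q * Real.log ρ)) * Real.exp (β * (|t| *
            (∑ u : TorusSite 2 L, ∑ v : TorusSite 2 L,
              (if (torusGraph 2 L).Adj u v then (Real.cosh (φ u - φ v) - 1) else 0)) +
            |t'| * ∑ u : TorusSite 2 L, ∑ v : TorusSite 2 L,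
              (if (torusDiagGraph L).Adj u v then (Real.cosh (φ u - φ v) - 1) else 0))) := key
      _ ≤ Real.exp (-2 * (2 * q * Real.log ρ)) * Real.exp (β * (|t| *
            (2 * (2 * Real.pi * q ^ 2 * (harmonic ρ : ℝ) + 76 * q ^ 2 +
              544 * q ^ 4 * Real.exp (2 * q ^ 2))) +
            |t'| * (2 * (4 * Real.pi * q ^ 2 * (harmonic ρ : ℝ) + 289 * q ^ 2 +
              3402 * q ^ 4 * Real.exp (2 * q ^ 2))))) := by
          gcongr
      _ ≤ Real.exp (-2 * (2 * q * Real.log ρ)) * Real.exp (β * (|t| *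
            (2 * (2 * Real.pi * q ^ 2 * (1 + Real.log ρ) + 76 * q ^ 2 +
              544 * q ^ 4 * Real.exp (2 * q ^ 2))) +
            |t'| * (2 * (4 * Real.pi * q ^ 2 * (1 + Real.log ρ) + 289 * q ^ 2 +
              3402 * q ^ 4 * Real.exp (2 * q ^ 2))))) := by
          gcongr
      _ = K * Real.exp (-(f * Real.log ρ)) := by
          rw [hK, ← Real.exp_add, ← Real.exp_add, hfdef]
          congr 1
          ring
      _ = K * (ρ : ℝ) ^ (-f) := by
          rw [Real.rpow_def_of_pos hρ0]
          congr 2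
          ring
      _ ≤ K * (((R : ℝ) + 1) / 5) ^ (-f) := by
          gcongr K * ?_
          exact Real.rpow_le_rpow_of_nonpos hfifth0 hfifth (by linarith)
      _ = K * ((5 : ℝ) ^ f * ((R : ℝ) + 1) ^ (-f)) := by
          rw [Real.div_rpow hR1.le (by norm_num), Real.rpow_neg (by norm_num : (0:ℝ) ≤ 5),
            div_inv_eq_mul, mul_comm (((R : ℝ) + 1) ^ (-f))]

/-! ### The sharp `η`-line of the `t–t'` model, torus-uniform form -/

/-- **Cor 10.1⁗ (torus form, `t–t'` model, sharp constant; PROVED below).** Grand-canonical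
`t–t'` Hubbard model `H_{t,t'}(U) - μN` on `(ℤ/Lℤ)²`, any real `t, t', U, μ`, `β > 0` with
`β(|t| + 2|t'|) < 4/π` (temperature `T > (π/4)(|t| + 2|t'|)`, the McBryan–Spencer/Koma–Tasaki
`η = 1/4` line of the class with the printed hopping norm; for `t' = -0.2t`: `T > 1.10|t|`):
there are `f > 1/4` and `C` with `|⟨c†_{x↑} c†_{x↓} c_{y↓} c_{y↑}⟩_{β,L}| ≤ C (dist(x,y)+1)^{-f}`
for EVERY `L ≥ 1` and all `x, y` — no Kosterlitz–Thouless pair quasi-condensate (`η ≤ 1/4`)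
there, whatever `U` and the filling. Improves `PairEtaLineDipoleTPrime` (`T ≥ 1.02(|t|+2|t'|)`)
by the factor `4/π`. kind: support (PROVED). Why it might fail: it cannot (proved); NOT claimed:
optimality of the exponent within the method (bounds.tex Thm 10 (iv)) or any bound on `T_BKT`.
Sources: KomaTasakiPRL1992 Theorem, eqs. (11)–(13), note 9; McBryanSpencer1977;
NelsonKosterlitz1977; XuEtAl2024 eq. (1); this cell bounds.tex Thm 10 / 10″. -/
@[conjecture] def PairEtaLineEuclidTPrime : Prop :=
  ∀ (t t' U μ β : ℝ), 0 < β → β * (|t| + 2 * |t'|) < 4 / Real.pi →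
    ∃ f C : ℝ, 1 / 4 < f ∧ ∀ (L : ℕ) [NeZero L] (x y : TorusSite 2 L),
      ‖(hubbardTorusTT' L t t' U - (μ : ℂ) • totalNumber).thermalCorr β
          (onSitePair x)ᴴ (onSitePair y)‖ ≤
        C * ((torusDist x y : ℝ) + 1) ^ (-f)

/-- **`PairEtaLineEuclidTPrime` holds** (with `b = β(|t| + 2|t'|)`: witness `q = 1/4` when
`πb ≤ 2`, `f = 1 - πb/4 ≥ 1/2`; else `q = 1/(2πb)`, `f = 1/(πb) > 1/4`; `C = K 5^f`). -/
theorem pairEtaLineEuclidTPrime_holds : PairEtaLineEuclidTPrime := by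
  intro t t' U μ β hβ hb
  set b : ℝ := β * (|t| + 2 * |t'|) with hbdef
  have hb0' : 0 ≤ b := by positivity
  have hπ := Real.pi_pos
  have hb4 : Real.pi * b < 4 := by
    have := (lt_div_iff₀ hπ).1 hb
    linarith
  by_cases hc : Real.pi * b ≤ 2
  · -- `q = 1/4`
    have hf0 : 0 ≤ 4 * (1 / 4 : ℝ) - 4 * Real.pi * b * (1 / 4 : ℝ) ^ 2 := by nlinarith
    refine ⟨4 * (1 / 4 : ℝ) - 4 * Real.pi * b * (1 / 4 : ℝ) ^ 2,
      Real.exp (2 * β * (|t| * (2 * Real.pi * (1 / 4 : ℝ) ^ 2 + 76 * (1 / 4 : ℝ) ^ 2 +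
          544 * (1 / 4 : ℝ) ^ 4 * Real.exp (2 * (1 / 4 : ℝ) ^ 2)) +
        |t'| * (4 * Real.pi * (1 / 4 : ℝ) ^ 2 + 289 * (1 / 4 : ℝ) ^ 2 +
          3402 * (1 / 4 : ℝ) ^ 4 * Real.exp (2 * (1 / 4 : ℝ) ^ 2)))) *
        (5 : ℝ) ^ (4 * (1 / 4 : ℝ) - 4 * Real.pi * b * (1 / 4 : ℝ) ^ 2),
      by nlinarith, fun L _ x y => ?_⟩
    rw [mul_assoc]
    exact norm_pairCorr_ttPrime_le_rpow_euclid L t t' U μ β (1 / 4) hβ.le (by norm_num) hf0 x y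
  · -- `q = q* = 1/(2πb)`
    have hc' : 2 < Real.pi * b := not_le.1 hc
    have hb0 : 0 < b := by
      rcases hb0'.eq_or_lt with h | h
      · rw [← h, mul_zero] at hc'; linarith
      · exact h
    set q : ℝ := 1 / (2 * Real.pi * b) with hq
    have hq0 : 0 ≤ q := by positivity
    have hfval : 4 * q - 4 * Real.pi * b * q ^ 2 = 1 / (Real.pi * b) := by
      rw [hq]
      field_simp
      ring
    have hf4 : 1 / 4 < 4 * q - 4 * Real.pi * b * q ^ 2 := by
      rw [hfval, div_lt_div_iff₀ (by norm_num) (by positivity)]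
      linarith
    refine ⟨4 * q - 4 * Real.pi * b * q ^ 2,
      Real.exp (2 * β * (|t| * (2 * Real.pi * q ^ 2 + 76 * q ^ 2 +
          544 * q ^ 4 * Real.exp (2 * q ^ 2)) +
        |t'| * (4 * Real.pi * q ^ 2 + 289 * q ^ 2 + 3402 * q ^ 4 * Real.exp (2 * q ^ 2)))) *
        (5 : ℝ) ^ (4 * q - 4 * Real.pi * b * q ^ 2), hf4, fun L _ x y => ?_⟩
    rw [mul_assoc]
    exact norm_pairCorr_ttPrime_le_rpow_euclid L t t' U μ β q hβ.le hq0 (by linarith) x y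

end Summit.HubbardSuperconductivity.HubbardLadder.Bounds

end
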